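import Summits.Ventures.QEC.Thresholds.RotatedSurfaceCodeSAWThresholds
import Literature.InformationTheory.QuantumCodes.RotatedSurfaceCodeLossErrorPhaseBoundary
import Literature.InformationTheory.QuantumCodes.RotatedSurfaceCodeErasureHalfX
import Literature.InformationTheory.QuantumCodes.CSSMixedChannelConverse
import Literature.InformationTheory.QuantumCodes.CSSMixedChannelFamilies
import HarnessLib

/-!
# The loss–error phase boundary of the ROTATED surface codes `RSC(L) = [[L², 1, L]]` (Surface-17 family)

Venture QEC, `Summits/Ventures/QEC/Thresholds/` (LADDER-QEC rung Q5; qec-type-03 gen 6, item «03.RSCPHASE»). The rotated companion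
of `ToricCodeLossErrorPhaseBoundary.lean` and `PlanarLossErrorPhaseBoundary.lean`: the family `fun i => RotatedSurface.code (i + 1)`
(`RSC(1), RSC(2), RSC(3) = Surface-17, …`; DEFINITIONALLY type-09's census abbreviation `rscCode i`, see `rsc_zMixedFamily_eq_rscCode`)
under heralded LOSSES (rate `y`, known locations) AND independent Pauli errors of the `H_X`-detected sector (rate `p`), decoded by
any family `D` of minimum-weight-outside-the-losses decoders; `p_c(y) := accuracyThreshold (i ↦ p ↦ Prob[failure])`.

The Literature side (`RotatedSurfaceCodeLossError{Runs,Skeletons,SkeletonSum,PhaseBoundary}.lean`) proves the Peierls argument on the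
degraded diagonal lattice GRANTED the odd-column property of the non-trivial logicals; this file discharges it from `k = 1`
(type-09's `rsc_colZero_eq_one`) and assembles the phase diagram — the ceiling and the vanishing beyond `1/2` are obtained here for
EVERY `L` (no sector symmetry needed) from the complementary-point inequality `1 ≤ 2 P^{mixed,Z}_{y,p} + P^X_{1-y-2p(1-y)}`
(lit-2's `CSSCode.one_le_two_mul_mixed_add_uncorrectable`) and the `X`-sector loss threshold `1/2` (`RotatedSurface.x_lossThreshold_half`):

| loss rate | certified statement | decl |
|---|---|---|
| `0 ≤ y < 1/2` | `0 < p_c(y)` (Peierls on the degraded lattice; BK + Kesten) | `rsc_mixed_accuracyThreshold_pos` |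
| `0 ≤ y < 1/2` | `p_c(y) ≤ (1 - 2y)/(4(1 - y))` for EVERY erasure-aware decoder family | `rsc_mixed_accuracyThreshold_le` |
| `1/2 ≤ y ≤ 1` | `p_c(y) = 0` for EVERY erasure-aware decoder family | `rsc_mixed_accuracyThreshold_eq_zero` |
| `p = 0` axis | loss threshold `= 1/2` exactly (both sectors) | `RotatedSurfaceLossThresholdHalf.lean` (type-03 g6) |

★ `rsc_mixed_accuracyThreshold_pos_iff : 0 < p_c(y) ↔ y < 1/2` (`0 ≤ y ≤ 1`); `rsc_lossError_correctableLossRates_eq = Set.Ico 0 (1/2)`.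
HONEST FRAMING: the numerical position of the boundary inside the strip `0 < p_c(y) ≤ (1-2y)/(4(1-y))` (Stace–Barrett 2010's
numerics) is not claimed; `p₀(y)` is Kesten's non-explicit decay rate fed through an explicit Peierls constant; the `H_Z` sector is
not asserted here. UNCONDITIONAL, 0 named facts.

## References

* [StaceBarrettDoherty2009] T. M. Stace, S. D. Barrett, A. C. Doherty, PRL 102 (2009) 200501, p. 1 (abstract), p. 2–3 and Fig. 2.
* [StaceBarrett2010] T. M. Stace, S. D. Barrett, PRA 81 (2010) 022317, arXiv:0912.1159 (surface codes with loss and errors).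
* [KestenCMP1980] H. Kesten, Comm. Math. Phys. 74 (1980) 41–59, Thm. 1, Thm. 2 (1.7).
* [DumerKovalevPryadko2015] I. Dumer, A. A. Kovalev, L. P. Pryadko, PRL 115 (2015) 050502, Thm. 2 (the decoder class).
* [BombinMartinDelgado2007Optimal] H. Bombin, M. A. Martin-Delgado, PRA 76 (2007) 012305, §IV (the rotated lattice, k = 1).
-/

noncomputable section

namespace Summit.Ventures.QEC.Thresholds

open Filter Topology Matrix
open Literature.InformationTheory.QuantumCodes
open Literature.InformationTheory.QuantumCodes.RotatedSurface

/-! ### `k = 1`: the odd-column property -/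

/-- **The odd-column property of `RSC(L)`** (the hypothesis `hL1` of the Literature files, discharged): every cycle of the
`H_X`-sector outside the stabilizer has an odd number of column-`0` qubits (one logical qubit).
[cite: BombinMartinDelgado2007Optimal, §IV (k = 1)] -/
theorem rsc_oddColumn (L : ℕ) (hL : 0 < L) :
    ∀ x : Fin L × Fin L → ZMod 2, HX L *ᵥ x = 0 → x ∉ (RotatedSurface.code L).rowSpZ → ∑ i : Fin L, x (i, ⟨0, hL⟩) = 1 :=
  fun _ hx hxS => rsc_colZero_eq_one hL hx hxS

/-! ### Census form of the family -/

/-- The census `H_X`-sector loss–error failure family of `fun i => RotatedSurface.code (i + 1)` IS the Literature family on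
`HX (i+1)`, `(code (i+1)).rowSpZ` (definitional). [cite: BombinMartinDelgado2007Optimal, §IV] -/
theorem rsc_zMixedFamily_eq
    (D : (i : ℕ) → ErasureDecoder (Fin (i + 1) × Fin (i + 1)) (Fin (i + 1 + 1) × Fin (i + 1 - 1) → ZMod 2)) (y : ℝ) :
    (fun i p => mixedFailureProb (RotatedSurface.code (i + 1)).HX
        ((RotatedSurface.code (i + 1)).rowSpZ : Set (Fin (i + 1) × Fin (i + 1) → ZMod 2)) (D i) y p) =
      fun i p => mixedFailureProb (HX (i + 1))
        ((RotatedSurface.code (i + 1)).rowSpZ : Set (Fin (i + 1) × Fin (i + 1) → ZMod 2)) (D i) y p := rfl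

/-- The same family written with type-09's census abbreviation `rscCode i = RotatedSurface.code (i + 1)` (definitional: the
two census presentations of the rotated surface codes are ONE object). [cite: BombinMartinDelgado2007Optimal, §IV] -/
theorem rsc_zMixedFamily_eq_rscCode
    (D : (i : ℕ) → ErasureDecoder (Fin (i + 1) × Fin (i + 1)) (Fin (i + 1 + 1) × Fin (i + 1 - 1) → ZMod 2)) (y : ℝ) :
    (fun i p => mixedFailureProb (rscCode i).HX ((rscCode i).rowSpZ : Set (Fin (i + 1) × Fin (i + 1) → ZMod 2)) (D i) y p) =
      fun i p => mixedFailureProb (RotatedSurface.code (i + 1)).HX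
        ((RotatedSurface.code (i + 1)).rowSpZ : Set (Fin (i + 1) × Fin (i + 1) → ZMod 2)) (D i) y p := rfl

/-! ### Below the percolation point: a positive error threshold, uniformly over decoders -/

/-- **Uniform exponential decay below a positive error rate**: for every loss rate `0 ≤ y < 1/2` ONE error rate `p₀(y) > 0`
works for all minimum-weight-outside-the-losses decoder families of the rotated surface codes at once: for `0 ≤ p ≤ p₀(y)` the
failure probability decays exponentially in `i`. [cite: StaceBarrettDoherty2009, p. 3 and Fig. 2] [cite: KestenCMP1980, Thm. 2 (1.7)] -/
theorem rsc_mixedFamily_decaysExponentially {y : ℝ} (hy0 : 0 ≤ y) (hy : y < 1 / 2) :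
    ∃ p₀ : ℝ, 0 < p₀ ∧
      ∀ (D : (i : ℕ) → ErasureDecoder (Fin (i + 1) × Fin (i + 1)) (Fin (i + 1 + 1) × Fin (i + 1 - 1) → ZMod 2)),
        (∀ i, (D i).IsMinWeightOutside (RotatedSurface.code (i + 1)).HX) →
          ∀ p : ℝ, 0 ≤ p → p ≤ p₀ → DecaysExponentially (fun i p => mixedFailureProb (RotatedSurface.code (i + 1)).HX
            ((RotatedSurface.code (i + 1)).rowSpZ : Set (Fin (i + 1) × Fin (i + 1) → ZMod 2)) (D i) y p) p :=
  rsc_mixedFamily_decaysExponentially_of_oddColumn (fun _ hL _ hx hxS => rsc_colZero_eq_one hL hx hxS) hy0 hy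

/-- **Positive error threshold below the percolation point**: for `0 ≤ y < 1/2` and every family of
minimum-weight-outside-the-losses decoders of the rotated surface codes, `0 < p_c(y)`.
[cite: StaceBarrettDoherty2009, p. 3 and Fig. 2] [cite: KestenCMP1980, Thm. 2 (1.7)] -/
theorem rsc_mixed_accuracyThreshold_pos
    (D : (i : ℕ) → ErasureDecoder (Fin (i + 1) × Fin (i + 1)) (Fin (i + 1 + 1) × Fin (i + 1 - 1) → ZMod 2))
    (hD : ∀ i, (D i).IsMinWeightOutside (RotatedSurface.code (i + 1)).HX) {y : ℝ} (hy0 : 0 ≤ y) (hy : y < 1 / 2) :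
    0 < accuracyThreshold (fun i p => mixedFailureProb (RotatedSurface.code (i + 1)).HX
      ((RotatedSurface.code (i + 1)).rowSpZ : Set (Fin (i + 1) × Fin (i + 1) → ZMod 2)) (D i) y p) := by
  obtain ⟨p₀, hp₀, h⟩ := rsc_mixedFamily_decaysExponentially hy0 hy
  have hlb : IsThresholdLowerBound (fun i p => mixedFailureProb (RotatedSurface.code (i + 1)).HX
      ((RotatedSurface.code (i + 1)).rowSpZ : Set (Fin (i + 1) × Fin (i + 1) → ZMod 2)) (D i) y p) (min p₀ 1) :=
    fun p hp0 hp => (h D hD p hp0 ((le_of_lt hp).trans (min_le_left _ _))).belowThreshold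
  exact lt_of_lt_of_le (lt_min hp₀ one_pos) (le_accuracyThreshold hlb (min_le_right _ _))

/-- **Uniform lower bound** (census reading): for `0 ≤ y < 1/2` one `p₀(y) > 0` satisfies `p₀(y) ≤ p_c(y)` for every
minimum-weight-outside-the-losses decoder family, with exponential decay for `p ≤ p₀(y)`.
[cite: StaceBarrettDoherty2009, p. 3 and Fig. 2] [cite: KestenCMP1980, Thm. 2 (1.7)] -/
theorem rsc_lossError_uniform_lowerBound {y : ℝ} (hy0 : 0 ≤ y) (hy : y < 1 / 2) :
    ∃ p₀ : ℝ, 0 < p₀ ∧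
      ∀ (D : (i : ℕ) → ErasureDecoder (Fin (i + 1) × Fin (i + 1)) (Fin (i + 1 + 1) × Fin (i + 1 - 1) → ZMod 2)),
        (∀ i, (D i).IsMinWeightOutside (RotatedSurface.code (i + 1)).HX) →
          p₀ ≤ accuracyThreshold (fun i p => mixedFailureProb (RotatedSurface.code (i + 1)).HX
            ((RotatedSurface.code (i + 1)).rowSpZ : Set (Fin (i + 1) × Fin (i + 1) → ZMod 2)) (D i) y p) ∧
          ∀ p : ℝ, 0 ≤ p → p ≤ p₀ → DecaysExponentially (fun i p => mixedFailureProb (RotatedSurface.code (i + 1)).HX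
            ((RotatedSurface.code (i + 1)).rowSpZ : Set (Fin (i + 1) × Fin (i + 1) → ZMod 2)) (D i) y p) p := by
  obtain ⟨p₀, hp₀, h⟩ := rsc_mixedFamily_decaysExponentially hy0 hy
  refine ⟨min p₀ 1, lt_min hp₀ one_pos, fun D hD => ⟨?_, fun p hp0 hp => h D hD p hp0 (hp.trans (min_le_left _ _))⟩⟩
  refine le_accuracyThreshold (fun p hp0 hp => ?_) (min_le_right _ _)
  exact (h D hD p hp0 ((le_of_lt hp).trans (min_le_left _ _))).belowThreshold

/-! ### The complementary point: no error rate beyond the curve `y + 2p(1-y) = 1/2`, for ANY erasure-aware decoder -/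

/-- **Beyond the curve `y + 2p(1-y) = 1/2` no decoder family is below threshold**: if `0 ≤ y ≤ 1`, `0 < q ≤ 1/2` and
`1/2 < y + 2q(1-y)`, then the failure probabilities of ANY erasure-aware decoder family of the rotated surface codes do NOT tend
to `0` at `(y, q)` — the `X`-sector loss pattern at the complementary rate `1 - y - 2q(1-y) < 1/2` is a.s. correctable in the limit
(`x_lossThreshold_half`), so `1 ≤ 2 P^{mixed}_{y,q} + o(1)`. [cite: StaceBarrettDoherty2009, p. 2 (the no-cloning boundary of the correctable region)] -/
theorem rsc_not_belowThreshold_of_gt_curve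
    (D : (i : ℕ) → ErasureDecoder (Fin (i + 1) × Fin (i + 1)) (Fin (i + 1 + 1) × Fin (i + 1 - 1) → ZMod 2))
    {y q : ℝ} (hy0 : 0 ≤ y) (hy1 : y ≤ 1) (hq0 : 0 < q) (hq2 : q ≤ 1 / 2) (hcurve : 1 / 2 < y + (1 - y) * (2 * q)) :
    ¬ BelowThreshold (fun i p => mixedFailureProb (RotatedSurface.code (i + 1)).HX
      ((RotatedSurface.code (i + 1)).rowSpZ : Set (Fin (i + 1) × Fin (i + 1) → ZMod 2)) (D i) y p) q := by
  classical
  intro hbelow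
  set y' : ℝ := y + (1 - y) * (2 * q) with hy'
  have hy'le : y' ≤ 1 := by
    have : (1 - y) * (2 * q) ≤ (1 - y) * 1 := mul_le_mul_of_nonneg_left (by linarith) (by linarith)
    linarith
  set X : ℕ → ℝ := fun i => ErasureDecoder.uncorrectableProb
    {x : Fin (i + 1) × Fin (i + 1) → ZMod 2 | (RotatedSurface.code (i + 1)).HZ *ᵥ x = 0}
    ((RotatedSurface.code (i + 1)).rowSpX : Set (Fin (i + 1) × Fin (i + 1) → ZMod 2)) (1 - y') with hX
  have hX0 : Tendsto X atTop (𝓝 0) := x_lossThreshold_half (1 - y') (by linarith) (by linarith)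
  have hle : ∀ i : ℕ, (1 : ℝ) ≤ 2 * mixedFailureProb (RotatedSurface.code (i + 1)).HX
      ((RotatedSurface.code (i + 1)).rowSpZ : Set (Fin (i + 1) × Fin (i + 1) → ZMod 2)) (D i) y q + X i := fun i =>
    (RotatedSurface.code (i + 1)).one_le_two_mul_mixed_add_uncorrectable
      (by rw [code_k (Nat.succ_pos i)]; exact one_pos) (D i) hy0 hy1 hq0.le hq2
  have hlim : Tendsto (fun i => 2 * mixedFailureProb (RotatedSurface.code (i + 1)).HX
      ((RotatedSurface.code (i + 1)).rowSpZ : Set (Fin (i + 1) × Fin (i + 1) → ZMod 2)) (D i) y q + X i)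
      atTop (𝓝 (2 * 0 + 0)) := (hbelow.const_mul 2).add hX0
  have h := le_of_tendsto_of_tendsto' tendsto_const_nhds hlim hle
  linarith

/-- **Beyond loss rate `1/2` the rotated surface codes tolerate no error rate**: for `1/2 ≤ y ≤ 1` and EVERY family of
erasure-aware decoders, `p_c(y) = 0`. [cite: StaceBarrettDoherty2009, p. 2–3 and Fig. 2 (no threshold beyond p_loss = 0.5)] -/
theorem rsc_mixed_accuracyThreshold_eq_zero
    (D : (i : ℕ) → ErasureDecoder (Fin (i + 1) × Fin (i + 1)) (Fin (i + 1 + 1) × Fin (i + 1 - 1) → ZMod 2))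
    {y : ℝ} (hy : 1 / 2 ≤ y) (hy1 : y ≤ 1) :
    accuracyThreshold (fun i p => mixedFailureProb (RotatedSurface.code (i + 1)).HX
      ((RotatedSurface.code (i + 1)).rowSpZ : Set (Fin (i + 1) × Fin (i + 1) → ZMod 2)) (D i) y p) = 0 := by
  set P : ℕ → ℝ → ℝ := fun i p => mixedFailureProb (RotatedSurface.code (i + 1)).HX
    ((RotatedSurface.code (i + 1)).rowSpZ : Set (Fin (i + 1) × Fin (i + 1) → ZMod 2)) (D i) y p with hP
  refine le_antisymm ?_ (accuracyThreshold_nonneg _)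
  by_contra hpos
  push Not at hpos
  set a := accuracyThreshold P with ha
  set q : ℝ := min (a / 2) (1 / 2) with hq
  have hq0 : 0 < q := lt_min (by linarith) (by norm_num)
  have hqa : q < a := lt_of_le_of_lt (min_le_left _ _) (by linarith)
  have hq2 : q ≤ 1 / 2 := min_le_right _ _
  have hbelow : BelowThreshold P q := belowThreshold_of_lt_accuracyThreshold hq0.le hqa
  have hcurve : 1 / 2 < y + (1 - y) * (2 * q) := by
    rcases eq_or_lt_of_le hy1 with h1 | h1
    · rw [h1]; norm_num
    · have : 0 < (1 - y) * (2 * q) := mul_pos (by linarith) (by linarith)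
      linarith
  exact rsc_not_belowThreshold_of_gt_curve D (by linarith) hy1 hq0 hq2 hcurve hbelow

/-- **The ceiling curve for the rotated surface codes, every decoder and every `L`**: at loss rate `0 ≤ y < 1/2` every
certified error-threshold lower bound `a` of ANY erasure-aware decoder family satisfies `a ≤ (1 - 2y)/(4(1 - y))`.
[cite: StaceBarrettDoherty2009, p. 2 and Fig. 2 (boundary of the correctable region)] -/
theorem rsc_mixed_threshold_le
    (D : (i : ℕ) → ErasureDecoder (Fin (i + 1) × Fin (i + 1)) (Fin (i + 1 + 1) × Fin (i + 1 - 1) → ZMod 2))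
    {y : ℝ} (hy0 : 0 ≤ y) (hy : y < 1 / 2) {a : ℝ}
    (ha : IsThresholdLowerBound (fun i p => mixedFailureProb (RotatedSurface.code (i + 1)).HX
      ((RotatedSurface.code (i + 1)).rowSpZ : Set (Fin (i + 1) × Fin (i + 1) → ZMod 2)) (D i) y p) a) :
    a ≤ (1 - 2 * y) / (4 * (1 - y)) := by
  by_contra h
  push Not at h
  set c₀ : ℝ := (1 - 2 * y) / (4 * (1 - y)) with hc₀
  have h1y : 0 < 1 - y := by linarith
  have hc₀0 : 0 ≤ c₀ := div_nonneg (by linarith) (by linarith)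
  have hc₀y : y + (1 - y) * (2 * c₀) = 1 / 2 := by
    rw [hc₀]; field_simp; ring
  set p₁ : ℝ := min ((a + c₀) / 2) (1 / 2) with hp₁
  have hp₁c : c₀ < p₁ := by
    refine lt_min (by linarith) ?_
    have : c₀ ≤ 1 / 4 := by
      rw [hc₀, div_le_iff₀ (by linarith)]; linarith
    linarith
  have hp₁a : p₁ < a := by
    rcases le_total ((a + c₀) / 2) (1 / 2) with hle | hle
    · rw [hp₁, min_eq_left hle]; linarith
    · rw [hp₁, min_eq_right hle]; linarith
  have hp₁0 : 0 < p₁ := lt_of_le_of_lt hc₀0 hp₁c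
  have hp₁2 : p₁ ≤ 1 / 2 := min_le_right _ _
  have hcurve : 1 / 2 < y + (1 - y) * (2 * p₁) := by
    have : (1 - y) * (2 * c₀) < (1 - y) * (2 * p₁) := mul_lt_mul_of_pos_left (by linarith) h1y
    linarith
  exact rsc_not_belowThreshold_of_gt_curve D hy0 (by linarith) hp₁0 hp₁2 hcurve (ha p₁ hp₁0.le hp₁a)

/-- Accuracy-threshold form of the ceiling: `p_c(y) ≤ (1 - 2y)/(4(1 - y))` for `0 ≤ y < 1/2`, every erasure-aware decoder family
of the rotated surface codes. [cite: StaceBarrettDoherty2009, p. 2 and Fig. 2] -/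
theorem rsc_mixed_accuracyThreshold_le
    (D : (i : ℕ) → ErasureDecoder (Fin (i + 1) × Fin (i + 1)) (Fin (i + 1 + 1) × Fin (i + 1 - 1) → ZMod 2))
    {y : ℝ} (hy0 : 0 ≤ y) (hy : y < 1 / 2) :
    accuracyThreshold (fun i p => mixedFailureProb (RotatedSurface.code (i + 1)).HX
      ((RotatedSurface.code (i + 1)).rowSpZ : Set (Fin (i + 1) × Fin (i + 1) → ZMod 2)) (D i) y p) ≤
      (1 - 2 * y) / (4 * (1 - y)) :=
  rsc_mixed_threshold_le D hy0 hy (isThresholdLowerBound_accuracyThreshold _)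

/-! ### The explicit Dumer–Kovalev–Pryadko region (loss rates below `1/3`) -/

/-- **The explicit region `3·(y + 2(1-y)√(p(1-p))) < 1`** (Dumer–Kovalev–Pryadko's Theorem 2 at check weight `4`, distance
`L`, `L²` qubits): for every family of minimum-weight-outside-the-losses decoders of the rotated surface codes and every such
`(y, p)` with `0 ≤ y ≤ 1`, `0 ≤ p ≤ 1/2`, the failure probability tends to `0` — an EXPLICIT error-threshold lower bound for
the loss rates `y < 1/3`, complementing the non-explicit `p₀(y)` of `rsc_mixed_accuracyThreshold_pos` on `[1/3, 1/2)`.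
[cite: DumerKovalevPryadko2015, Thm 2 (w = 4)] -/
theorem rsc_mixedThreshold_dkp
    (D : (i : ℕ) → ErasureDecoder (Fin (i + 1) × Fin (i + 1)) (Fin (i + 1 + 1) × Fin (i + 1 - 1) → ZMod 2))
    (hD : ∀ i, (D i).IsMinWeightOutside (RotatedSurface.code (i + 1)).HX)
    {y p : ℝ} (hy0 : 0 ≤ y) (hy1 : y ≤ 1) (hp0 : 0 ≤ p) (hp : p ≤ 1 / 2) (hr : 3 * upsilonCSS y p < 1) :
    Tendsto (fun i => mixedFailureProb (RotatedSurface.code (i + 1)).HX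
      ((RotatedSurface.code (i + 1)).rowSpZ : Set (Fin (i + 1) × Fin (i + 1) → ZMod 2)) (D i) y p) atTop (𝓝 0) :=
  mixedThreshold_of_rowWeight' (fun i => HX (i + 1)) (fun i => (RotatedSurface.code (i + 1)).rowSpZ) D hD (w := 4)
    (by norm_num) (fun i x => card_rowSupp_HX_le (i + 1) x) (fun i => i + 1) (fun i => by omega) rsc_le_weight_z rsc_growth
    hy0 hy1 hp0 hp (by norm_num; linarith)

/-! ### ★ The phase boundary -/

/-- ★ **THE LOSS–ERROR PHASE BOUNDARY OF THE ROTATED SURFACE CODES** (Surface-17 family): for a loss rate `0 ≤ y ≤ 1` and any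
family of minimum-weight-outside-the-losses decoders, `fun i => RotatedSurface.code (i + 1)` has a POSITIVE error accuracy
threshold at loss rate `y` if and only if `y < 1/2` — the bond-percolation threshold of the square lattice (Kesten).
[cite: StaceBarrettDoherty2009, p. 1 (abstract) and Fig. 2] [cite: StaceBarrett2010, abstract] [cite: KestenCMP1980, Thm. 1] -/
theorem rsc_mixed_accuracyThreshold_pos_iff
    (D : (i : ℕ) → ErasureDecoder (Fin (i + 1) × Fin (i + 1)) (Fin (i + 1 + 1) × Fin (i + 1 - 1) → ZMod 2))
    (hD : ∀ i, (D i).IsMinWeightOutside (RotatedSurface.code (i + 1)).HX) {y : ℝ} (hy0 : 0 ≤ y) (hy1 : y ≤ 1) :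
    0 < accuracyThreshold (fun i p => mixedFailureProb (RotatedSurface.code (i + 1)).HX
      ((RotatedSurface.code (i + 1)).rowSpZ : Set (Fin (i + 1) × Fin (i + 1) → ZMod 2)) (D i) y p) ↔ y < 1 / 2 := by
  constructor
  · intro h
    by_contra hge
    push Not at hge
    have := rsc_mixed_accuracyThreshold_eq_zero D hge hy1
    linarith
  · exact rsc_mixed_accuracyThreshold_pos D hD hy0

/-- ★ **The certified loss–error phase diagram of the rotated surface codes** (all decoder families of the
minimum-weight-outside-the-losses class): below the percolation point the error threshold is POSITIVE and at most the ceiling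
`(1 - 2y)/(4(1 - y))`; from the percolation point on it VANISHES. [cite: StaceBarrettDoherty2009, p. 2–3 and Fig. 2] [cite: KestenCMP1980, Thm. 1] -/
theorem rsc_lossError_phaseDiagram
    (D : (i : ℕ) → ErasureDecoder (Fin (i + 1) × Fin (i + 1)) (Fin (i + 1 + 1) × Fin (i + 1 - 1) → ZMod 2))
    (hD : ∀ i, (D i).IsMinWeightOutside (RotatedSurface.code (i + 1)).HX) {y : ℝ} (hy0 : 0 ≤ y) (hy1 : y ≤ 1) :
    (y < 1 / 2 →
        0 < accuracyThreshold (fun i p => mixedFailureProb (RotatedSurface.code (i + 1)).HX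
          ((RotatedSurface.code (i + 1)).rowSpZ : Set (Fin (i + 1) × Fin (i + 1) → ZMod 2)) (D i) y p) ∧
        accuracyThreshold (fun i p => mixedFailureProb (RotatedSurface.code (i + 1)).HX
          ((RotatedSurface.code (i + 1)).rowSpZ : Set (Fin (i + 1) × Fin (i + 1) → ZMod 2)) (D i) y p) ≤
          (1 - 2 * y) / (4 * (1 - y))) ∧
      (1 / 2 ≤ y →
        accuracyThreshold (fun i p => mixedFailureProb (RotatedSurface.code (i + 1)).HX
          ((RotatedSurface.code (i + 1)).rowSpZ : Set (Fin (i + 1) × Fin (i + 1) → ZMod 2)) (D i) y p) = 0) :=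
  ⟨fun hy => ⟨rsc_mixed_accuracyThreshold_pos D hD hy0 hy, rsc_mixed_accuracyThreshold_le D hy0 hy⟩,
    fun hy => rsc_mixed_accuracyThreshold_eq_zero D hy hy1⟩

/-- ★ **The loss rates with a positive error threshold are EXACTLY `[0, 1/2)`**: for every family of
minimum-weight-outside-the-losses decoders of the rotated surface codes, `{y ∈ [0,1] | 0 < p_c(y)} = [0, 1/2)`.
[cite: StaceBarrettDoherty2009, p. 1 (abstract: the maximum tolerable loss rate is 50%) and Fig. 2] [cite: KestenCMP1980, Thm. 1] -/
theorem rsc_lossError_correctableLossRates_eq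
    (D : (i : ℕ) → ErasureDecoder (Fin (i + 1) × Fin (i + 1)) (Fin (i + 1 + 1) × Fin (i + 1 - 1) → ZMod 2))
    (hD : ∀ i, (D i).IsMinWeightOutside (RotatedSurface.code (i + 1)).HX) :
    {y : ℝ | 0 ≤ y ∧ y ≤ 1 ∧ 0 < accuracyThreshold (fun i p => mixedFailureProb (RotatedSurface.code (i + 1)).HX
        ((RotatedSurface.code (i + 1)).rowSpZ : Set (Fin (i + 1) × Fin (i + 1) → ZMod 2)) (D i) y p)} =
      Set.Ico 0 (1 / 2) := by
  ext y
  simp only [Set.mem_setOf_eq, Set.mem_Ico]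
  constructor
  · rintro ⟨hy0, hy1, hpos⟩
    exact ⟨hy0, (rsc_mixed_accuracyThreshold_pos_iff D hD hy0 hy1).1 hpos⟩
  · rintro ⟨hy0, hy⟩
    exact ⟨hy0, by linarith, rsc_mixed_accuracyThreshold_pos D hD hy0 hy⟩

/-! ### Non-vacuity: the canonical decoders, and both sides of the boundary exhibited -/

/-- **Non-vacuity of the decoder class and of BOTH directions of the `↔`**: with the canonical
minimum-weight-outside-the-losses decoders of the rotated surface codes, the error threshold is POSITIVE at loss rate `1/4` and
ZERO at loss rate `1/2`. [cite: DumerKovalevPryadko2015, p. 3 (exhaustive search decoder)] [cite: StaceBarrettDoherty2009, Fig. 2] -/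
theorem rsc_lossError_nonvacuous :
    0 < accuracyThreshold (fun i p => mixedFailureProb (RotatedSurface.code (i + 1)).HX
        ((RotatedSurface.code (i + 1)).rowSpZ : Set (Fin (i + 1) × Fin (i + 1) → ZMod 2))
        (ErasureDecoder.minWeightOutside (HX (i + 1))) (1 / 4) p) ∧
      accuracyThreshold (fun i p => mixedFailureProb (RotatedSurface.code (i + 1)).HX
        ((RotatedSurface.code (i + 1)).rowSpZ : Set (Fin (i + 1) × Fin (i + 1) → ZMod 2))
        (ErasureDecoder.minWeightOutside (HX (i + 1))) (1 / 2) p) = 0 :=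
  ⟨rsc_mixed_accuracyThreshold_pos (fun i => ErasureDecoder.minWeightOutside (HX (i + 1)))
      (fun i => ErasureDecoder.minWeightOutside_isMinWeightOutside (HX (i + 1))) (by norm_num) (by norm_num),
    rsc_mixed_accuracyThreshold_eq_zero _ (by norm_num) (by norm_num)⟩

/-- **Non-vacuity, general loss rate**: with the canonical minimum-weight-outside-the-losses decoders the rotated surface codes
have a positive error threshold at every loss rate `0 ≤ y < 1/2`. [cite: DumerKovalevPryadko2015, p. 3 (exhaustive search decoder)] -/
theorem rsc_lossError_accuracyThreshold_pos_minWeightOutside {y : ℝ} (hy0 : 0 ≤ y) (hy : y < 1 / 2) :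
    0 < accuracyThreshold (fun i p => mixedFailureProb (RotatedSurface.code (i + 1)).HX
      ((RotatedSurface.code (i + 1)).rowSpZ : Set (Fin (i + 1) × Fin (i + 1) → ZMod 2))
      (ErasureDecoder.minWeightOutside (HX (i + 1))) y p) :=
  rsc_mixed_accuracyThreshold_pos _ (fun i => ErasureDecoder.minWeightOutside_isMinWeightOutside (HX (i + 1))) hy0 hy

end Summit.Ventures.QEC.Thresholds
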